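import Summits.HodgeConjecture.HodgeConjecture.Theorems.LinearSystemTorelliMiddleDivisorSupportFourfoldOfPeriodDeficiency

/-!
# Route `LinearSystemTorelli` — support item `MiddleDivisorSupport` (stmt-HodgeConjecture-1081, all even
# dimensions) is downstream of route `PeriodDeficiency` (kernel-checked)

Helper file for the support item stmt-HodgeConjecture-1081 `LinearSystemTorelli.MiddleDivisorSupport`
(`--supports`; it closes nothing) — every rational `(p,p)` class in the middle degree of a smooth
projective `2p`-fold (`p ≥ 1`) is supported on a divisor (shared verbatim with route `NodalSupport`;
its `p = 2` instance is the crux `MiddleDivisorSupportFourfold`, stmt-2409). The `ℚ̄`-funnel landed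
for the fourfold crux (lead c3 of stmt-2409: `linearSystemTorelli_dominantQbarEnvelope_of_qbarGenericIsHodgeGeneric`,
all `(n,p)`, p119707; glue of p117963) is dimension-free, so the same seven hypotheses give the
general item:

  ClassicalGeometricVHS → QbarGenericIsHodgeGeneric → HodgeConjectureQbar →
    bku_finite_monodromyOrbit_of_isHodgeGenericIn → riemannExistence_qbarDescent_of_finiteIndex →
    deligne_globalInvariantCycles → charlesSchnell2014_algebraicClasses_supportedOn_qbarClosed →
    MiddleDivisorSupport.

* `linearSystemTorelli_qbarDivisorSupport_of_hodgeConjectureQbar_codim` — `ℚ̄`-rational PROPER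
  support of rational `(p,p)` classes (`p ≥ 1`) on smooth projective `W₀ ⊗_σ ℂ`, from the Hodge
  conjecture over `ℚ̄` and the Charles–Schnell `ℚ̄`-support fact (generalises the codimension-2
  `linearSystemTorelli_qbarDivisorSupport_of_hodgeConjectureQbar`);
* `linearSystemTorelli_middleDivisorSupport_of_periodDeficiency` — the item from the seven hypotheses.
-/

-- every declaration of this problem lives in `Summit.HodgeConjecture.HodgeConjecture.…`
set_option linter.dupNamespace false

noncomputable section

namespace Summit.HodgeConjecture.HodgeConjecture.Theorems

open CategoryTheory AlgebraicGeometry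
open _root_.Topology
open Summit.HodgeConjecture.HodgeConjecture.Theses
open Literature.AlgebraicGeometry Literature.AlgebraicGeometry.Motives
open Literature.AlgebraicGeometry.HodgeTheory
open Literature.AlgebraicTopology.SingularHomology

/-- **`ℚ̄`-rational proper support in codimension `p ≥ 1` ⟸ HC over `ℚ̄`, granted Charles–Schnell's
remark.** For a fixed `σ`: if the Hodge conjecture holds for every smooth projective `W₀ ⊗_{ℚ̄,σ} ℂ`
(`PeriodDeficiency.HodgeConjectureQbar`, stmt-11596), then every rational `(p,p)` class on such a
variety dies off `π⁻¹ Z₀` for a Zariski-closed `Z₀ ⊆ W₀` of codimension `≥ p` (the named fact), which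
is proper as soon as `p ≥ 1` because `W₀` is irreducible.
[cite: CharlesSchnell2014Notes, Cor. 11.3.16 and the Remark following it] -/
theorem linearSystemTorelli_qbarDivisorSupport_of_hodgeConjectureQbar_codim
    (hF : charlesSchnell2014_algebraicClasses_supportedOn_qbarClosed)
    (h : PeriodDeficiency.HodgeConjectureQbar) (σ : AlgebraicClosure ℚ →+* ℂ) {p : ℕ} (hp : 1 ≤ p)
    ⦃m : ℕ⦄ (W₀ : SchemeOver (AlgebraicClosure ℚ)) (hW : IsSmoothProjective m ((baseChangeHom σ).obj W₀))
    (c' : complexBetti ((baseChangeHom σ).obj W₀) (2 * p)) (hc' : IsRationalClass c')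
    (hh' : IsOfHodgeType m ((baseChangeHom σ).obj W₀) (2 * p) p p c') :
    ∃ Z₀ : Set W₀.left, IsClosed Z₀ ∧ Z₀ ≠ Set.univ ∧
      complexBetti.restrictCompl ((baseChangeHom σ).obj W₀)
        ((baseChangeHomFst σ W₀).base ⁻¹' Z₀) (2 * p) c' = 0 := by
  obtain ⟨Z₀, hZ₀, hcoh, hd⟩ := hF σ W₀ hW p c' ((h σ hW).2 p c' hc' hh')
  haveI := irreducibleSpace_of_isSmoothProjective' hW
  haveI := irreducibleSpace_of_irreducibleSpace_baseChangeHom_obj σ W₀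
  exact ⟨Z₀, hZ₀, linearSystemTorelli_ne_univ_of_forall_le_coheight_of_irreducibleSpace hp hcoh, hd⟩

/-- **stmt-1081 ⟸ route `PeriodDeficiency`** (kernel-checked dedup, all even dimensions): every
rational `(p,p)` class `c` in the middle degree of a smooth projective complex `2p`-fold, `p ≥ 1`, is
supported on a divisor, granted `ClassicalGeometricVHS` (stmt-11597), `QbarGenericIsHodgeGeneric`
(stmt-11595), `HodgeConjectureQbar` (stmt-11596) and the named facts
`bku_finite_monodromyOrbit_of_isHodgeGenericIn`, `FundamentalGroup.riemannExistence_qbarDescent_of_finiteIndex`,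
`deligne_globalInvariantCycles`, `charlesSchnell2014_algebraicClasses_supportedOn_qbarClosed`: take the
dominant `ℚ̄`-envelope `c = ι^* c'` (`linearSystemTorelli_dominantQbarEnvelope_of_qbarGenericIsHodgeGeneric`),
a proper `ℚ̄`-closed `Z₀ ⊊ W₀` off whose preimage `c'` dies
(`linearSystemTorelli_qbarDivisorSupport_of_hodgeConjectureQbar_codim`), and pull the complement
back along the dominant map (`linearSystemTorelli_map_mem_supportedClasses_one_of_preimage_ne_univ`):
`ι⁻¹ π⁻¹ Z₀` is a proper closed subset of the integral `2p`-fold. No cycle class / Fulton is used.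
[cite: Voisin2007HodgeLoci, §3, proof of Prop. 0.7] [cite: CharlesSchnell2014Notes, Thm. 11.3.19 and Remark after Cor. 11.3.16]
[cite: GrothendieckTopology1969, §1] -/
theorem linearSystemTorelli_middleDivisorSupport_of_periodDeficiency :
    Summit.HodgeConjecture.HodgeConjecture.Theses.PeriodDeficiency.ClassicalGeometricVHS →
    Summit.HodgeConjecture.HodgeConjecture.Theses.PeriodDeficiency.QbarGenericIsHodgeGeneric →
    Summit.HodgeConjecture.HodgeConjecture.Theses.PeriodDeficiency.HodgeConjectureQbar →
    Literature.AlgebraicGeometry.HodgeTheory.bku_finite_monodromyOrbit_of_isHodgeGenericIn →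
    Literature.AlgebraicGeometry.FundamentalGroup.riemannExistence_qbarDescent_of_finiteIndex →
    Literature.AlgebraicGeometry.HodgeTheory.deligne_globalInvariantCycles →
    Literature.AlgebraicGeometry.HodgeTheory.charlesSchnell2014_algebraicClasses_supportedOn_qbarClosed →
    Summit.HodgeConjecture.HodgeConjecture.Theses.LinearSystemTorelli.MiddleDivisorSupport := by
  intro hC hG hQ hB hRE hD hF p X hp hX c hc hh
  obtain ⟨σ⟩ := exists_ringHom_algebraicClosure_rat_complex
  obtain ⟨m, W₀, ι, c', hW, hdom, hc', hh', hmap⟩ :=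
    linearSystemTorelli_dominantQbarEnvelope_of_qbarGenericIsHodgeGeneric hC hG hB hRE hD σ hX p c hc hh
  obtain ⟨Z₀, hZ₀, hZ₀ne, hd⟩ :=
    linearSystemTorelli_qbarDivisorSupport_of_hodgeConjectureQbar_codim hF hQ σ hp W₀ hW c' hc' hh'
  rw [← hmap]
  -- `ι⁻¹(π⁻¹ Z₀) = (ι ≫ π)⁻¹ Z₀` definitionally (`Scheme.comp_base` is `rfl`)
  exact linearSystemTorelli_map_mem_supportedClasses_one_of_preimage_ne_univ hX ι
    (hZ₀.preimage (baseChangeHomFst σ W₀).continuous)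
    (linearSystemTorelli_preimage_ne_univ_of_denseRange hdom hZ₀ hZ₀ne) hd

end Summit.HodgeConjecture.HodgeConjecture.Theorems

end
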